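import Summits.ValiantsHypothesis.ValiantsHypothesis.Theorems.BarrierLeverPartitionMinorsHitByVPMooreBallBall

/-!
# Route BarrierLever — item `PartitionMinorsHitByVP` (stmt-ValiantsHypothesis-19717):
# DOWN-CLOSED set families as index types — deletion, link and the split at `0` (definitions)

Helper file (`--supports stmt-ValiantsHypothesis-19717`; cell valiant-natproofs, rung V4, 𝒟-side door (c); prover
seat val-np-p6 gen 6). DEFINITIONS ONLY (plus bookkeeping lemmas); the mathematics — the peel of the Moore determinant
of a «same complex on both sides» layout and the unconditional class «rows and columns run through the SAME set
family» (all generalized principal minors of the partition matrix) — is in the companion `…HitByVPSamePattern`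
(definition-free), which imports this file. Generalises `…HitByVPMooreBallBallDefs` (balls ↦ arbitrary down-closed
families = simplicial complexes).

* `Fam F` — the members of a set family `F : Finset (Finset (Fin n))` as a finite index type.
* `famDel F = {S' : S'.map succ ∈ F}`, `famLink F = {S' : insert 0 (S'.map succ) ∈ F}` (families over `Fin n` for
  `F` over `Fin (n+1)`): deletion and link of the vertex `0`; for down-closed `F`, `famLink F ⊆ famDel F`
  (`famLink_subset_famDel`), both are down-closed (`isDownClosed_famDel`, `isDownClosed_famLink`).
* `famSplit F : Fam F ≃ Fam (famDel F) ⊕ Fam (famLink F)` — the split at `0` (via `dropZero` of `…MooreBallBallDefs`).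
* `famLinkIncl` — the inclusion `Fam (famLink F) → Fam (famDel F)` for down-closed `F`.
* `spMatrix p n d F = [ballEta S ^ ballWt d T]_{S, T ∈ Fam F}` — the Moore matrix of the layout «rows = F (node side),
  columns = F (digit side)», node `a` ↔ digit `a`.

WHAT THIS IS NOT: no theorem about item 19717 here; nothing on crux 14610 or VP vs VNP.
-/

set_option linter.dupNamespace false

namespace Summit.ValiantsHypothesis.ValiantsHypothesis.Theorems.BarrierLever.FrobeniusDoor

open Finset MvPolynomial Matrix

noncomputable section

/-! ## 1. Families as index types; down-closedness -/

/-- The members of a set family as a finite type. -/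
abbrev Fam {n : ℕ} (F : Finset (Finset (Fin n))) : Type := {S : Finset (Fin n) // S ∈ F}

/-- Down-closed set family (abstract simplicial complex, possibly without `∅` if empty): subsets of members are members. -/
def IsDownClosedFam {n : ℕ} (F : Finset (Finset (Fin n))) : Prop := ∀ S ∈ F, ∀ T, T ⊆ S → T ∈ F

variable (p : ℕ)

/-- The Moore matrix of the «same family on both sides» layout: `[η_S ^ (Σ_{c ∈ T} p^{d c})]_{S, T ∈ F}` — rows read
`S` as a set of NODES (`ballEta`), columns read `T` as a set of DIGITS (`ballWt`), node `a` ↔ digit `a`. -/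
def spMatrix (n : ℕ) (d : Fin n → ℕ) (F : Finset (Finset (Fin n))) :
    Matrix (Fam F) (Fam F) (MvPolynomial (Fin (n + 1)) (ZMod p)) :=
  Matrix.of fun S T => ballEta p n S.1 ^ ballWt p n d T.1

/-! ## 2. Deletion, link and the split at vertex `0` -/

/-- Deletion of vertex `0`, shifted down: `{S' ⊆ Fin n : S'.map succ ∈ F}`. -/
def famDel {n : ℕ} (F : Finset (Finset (Fin (n + 1)))) : Finset (Finset (Fin n)) :=
  Finset.univ.filter fun S' => S'.map (Fin.succEmb n) ∈ F

/-- Link of vertex `0`, shifted down: `{S' ⊆ Fin n : insert 0 (S'.map succ) ∈ F}`. -/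
def famLink {n : ℕ} (F : Finset (Finset (Fin (n + 1)))) : Finset (Finset (Fin n)) :=
  Finset.univ.filter fun S' => insert 0 (S'.map (Fin.succEmb n)) ∈ F

/-- Membership in the deletion. -/
theorem mem_famDel {n : ℕ} (F : Finset (Finset (Fin (n + 1)))) (S' : Finset (Fin n)) :
    S' ∈ famDel F ↔ S'.map (Fin.succEmb n) ∈ F := by simp [famDel]

/-- Membership in the link. -/
theorem mem_famLink {n : ℕ} (F : Finset (Finset (Fin (n + 1)))) (S' : Finset (Fin n)) :
    S' ∈ famLink F ↔ insert 0 (S'.map (Fin.succEmb n)) ∈ F := by simp [famLink]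

/-- For a down-closed family the link is contained in the deletion. -/
theorem famLink_subset_famDel {n : ℕ} {F : Finset (Finset (Fin (n + 1)))} (hF : IsDownClosedFam F) :
    famLink F ⊆ famDel F := by
  intro S' hS'
  rw [mem_famLink] at hS'
  rw [mem_famDel]
  exact hF _ hS' _ (Finset.subset_insert _ _)

/-- The deletion of a down-closed family is down-closed. -/
theorem isDownClosed_famDel {n : ℕ} {F : Finset (Finset (Fin (n + 1)))} (hF : IsDownClosedFam F) :
    IsDownClosedFam (famDel F) := by
  intro S hS T hT
  rw [mem_famDel] at hS ⊢
  exact hF _ hS _ (Finset.map_subset_map.mpr hT)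

/-- The link of a down-closed family is down-closed. -/
theorem isDownClosed_famLink {n : ℕ} {F : Finset (Finset (Fin (n + 1)))} (hF : IsDownClosedFam F) :
    IsDownClosedFam (famLink F) := by
  intro S hS T hT
  rw [mem_famLink] at hS ⊢
  exact hF _ hS _ (Finset.insert_subset_insert _ (Finset.map_subset_map.mpr hT))

/-- **The split at vertex `0`**: members avoiding `0` ↔ the deletion, members containing `0` ↔ the link. -/
def famSplit {n : ℕ} (F : Finset (Finset (Fin (n + 1)))) : Fam F ≃ Fam (famDel F) ⊕ Fam (famLink F) where
  toFun S := if h0 : (0 : Fin (n + 1)) ∈ S.1 then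
      Sum.inr ⟨dropZero S.1, by
        rw [mem_famLink, map_succEmb_dropZero_of_mem, Finset.insert_erase h0]; exact S.2⟩
    else Sum.inl ⟨dropZero S.1, by rw [mem_famDel, map_succEmb_dropZero_of_not_mem _ h0]; exact S.2⟩
  invFun := Sum.elim (fun S' => ⟨S'.1.map (Fin.succEmb n), (mem_famDel F S'.1).mp S'.2⟩)
    (fun S' => ⟨insert 0 (S'.1.map (Fin.succEmb n)), (mem_famLink F S'.1).mp S'.2⟩)
  left_inv S := by
    by_cases h0 : (0 : Fin (n + 1)) ∈ S.1
    · simp only [h0, ↓reduceDIte, Sum.elim_inr]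
      apply Subtype.ext
      simp only
      rw [map_succEmb_dropZero_of_mem, Finset.insert_erase h0]
    · simp only [h0, ↓reduceDIte, Sum.elim_inl]
      apply Subtype.ext
      simp only
      rw [map_succEmb_dropZero_of_not_mem _ h0]
  right_inv := by
    rintro (S' | S')
    · have h0 : (0 : Fin (n + 1)) ∉ S'.1.map (Fin.succEmb n) := by simp [Fin.succ_ne_zero]
      simp only [Sum.elim_inl, h0, ↓reduceDIte, dropZero_map_succEmb]
    · have h0 : (0 : Fin (n + 1)) ∈ insert 0 (S'.1.map (Fin.succEmb n)) := Finset.mem_insert_self _ _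
      simp only [Sum.elim_inr, h0, ↓reduceDIte, dropZero_insert_zero_map_succEmb]

/-- The inverse split on the deletion summand is the shift. -/
theorem famSplit_symm_inl {n : ℕ} (F : Finset (Finset (Fin (n + 1)))) (S' : Fam (famDel F)) :
    ((famSplit F).symm (Sum.inl S')).1 = S'.1.map (Fin.succEmb n) := rfl

/-- The inverse split on the link summand is `insert 0 ∘ shift`. -/
theorem famSplit_symm_inr {n : ℕ} (F : Finset (Finset (Fin (n + 1)))) (S' : Fam (famLink F)) :
    ((famSplit F).symm (Sum.inr S')).1 = insert 0 (S'.1.map (Fin.succEmb n)) := rfl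

/-- The inclusion of the link into the deletion (down-closed families). -/
def famLinkIncl {n : ℕ} {F : Finset (Finset (Fin (n + 1)))} (hF : IsDownClosedFam F) (S : Fam (famLink F)) :
    Fam (famDel F) := ⟨S.1, famLink_subset_famDel hF S.2⟩

end

end Summit.ValiantsHypothesis.ValiantsHypothesis.Theorems.BarrierLever.FrobeniusDoor
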